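import Mathlib.Analysis.CStarAlgebra.Matrix
import Mathlib.Topology.Algebra.InfiniteSum.Basic
import Literature.MathematicalPhysics.QuantumLattice.FinDimSpectrum
import Literature.MathematicalPhysics.QuantumLattice.SpinSystem
import Literature.MathematicalPhysics.QuantumLattice.LocalDynamics
import Literature.Probability.LatticeModels.LatticeGraph
import Literature.Probability.LatticeModels.ThermodynamicLimit
import HarnessLib

-- provenance: harness21/H21/H21/Prelude/QLatticeAQFT/InfiniteVolumeStates.lean @ 232d1f3 (interim HEAD d8f2665); M5 mechanical rewrite
/-!
# Infinite-volume states of quantum spin systems (trunk QLatticeAQFT, item Q13; outline Q-D3)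

Notion `quasi_local_algebra`, the part expressible without C⋆-inductive limits. The local
algebras `𝔄_Λ = Op ↥Λ q` (`Λ : Finset ℤ^d`, item Q3 `SpinSystem`) form a directed system under
isotony `embedOp h : 𝔄_Λ → 𝔄_{Λ'}` (`h : Λ ⊆ Λ'`). A state of the quasi-local algebra
`𝔄 = closure (⋃_Λ 𝔄_Λ)` restricts to a *compatible family* of states on the `𝔄_Λ`, and conversely
(item Q15 `QuasiLocalAlgebra` proves the correspondence); here an **infinite-volume state** *is*
such a family (`InfVolState d q`, a hypothesis structure with real fields).

Contents:
* `InfVolState d q`, lattice translations `InfVolState.shift v ω` (a genuine `InfVolState`, all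
  fields proved), `InfVolState.IsTranslationInvariant`, `InfVolState.IsRotationInvariant`
  (global `SU(2)` rotations `globalRotation`), two-point functions `InfVolState.corr`, convex
  combinations `InfVolState.mix`;
* thermodynamic limits along boxes: `InfVolState.IsBoxLimitOf ω ψ` (vector states `ψ_L` on
  `box d L`), `InfVolState.IsGibbsBoxLimitOf ω Φ β` (Gibbs states of `boxHamiltonian Φ L`);
* the generator of the dynamics of a finite-range interaction on local observables:
  `thicken Λ R` (the `R`-neighbourhood of `Λ`), `derivation Φ R Λ A = i [H_{thicken Λ R}, A]`;
* ground states and gapped ground states by the local (Bratteli–Robinson) criteria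
  `InfVolState.IsGroundState`, `InfVolState.IsGappedGroundState`, and `groundStates`,
  `HasUniqueGroundState`, `HasUniqueGappedGroundState`;
* API (sorried): `embedOp_eq_localOp`, `derivation_indep_of_range`,
  `InfVolState.IsGroundState.of_isBoxLimitOf`, `InfVolState.norm_expect_le`, `groundStates_convex`.

## Sources

* O. Bratteli, D. W. Robinson, *Operator Algebras and Quantum Statistical Mechanics II* (2nd ed.,
  Springer 1997): §6.2.1 (quasi-local algebra of a spin system, isotony, translations), Prop.
  5.3.19 and Def. 5.3.18 (ground states: `-i ω(A⋆ δ(A)) ≥ 0`), Thm. 6.2.4 and eq. (6.2.9)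
  (`δ(A) = i [H_Λ', A]` for `A ∈ 𝔄_Λ`, finite range), §6.2.7 (ground states of spin systems).
* H. Tasaki, *Physics and Mathematics of Quantum Many-Body Systems* (Springer 2020), App. A.7
  (states on the infinite chain as limits of finite-volume states; ground states; unique gapped
  ground state, Def. A.14–A.16).
* B. Nachtergaele, R. Sims, *Lieb–Robinson bounds and the exponential clustering theorem*,
  Comm. Math. Phys. 265 (2006), §2.

## Mathlib search and design notes

* Mathlib has abstract states on C⋆-algebras only implicitly (`PositiveLinearMap`, no `State`
  structure at this pin; `rg "structure State"`, `rg -i "quasi.?local"` find nothing), and no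
  inductive systems of matrix algebras; `Matrix.reindexLinearEquiv`, `Finset.subtype`,
  `Matrix.toEuclideanLin`, `Complex` with `open scoped ComplexOrder` are used.
* Positivity and the ground-state inequalities are written in Mathlib's (scoped) `ComplexOrder`
  on `ℂ` (`0 ≤ z ↔ 0 ≤ z.re ∧ z.im = 0`, `Complex.nonneg_iff`), as in the accepted
  `Matrix.gibbsState_nonneg_of_posSemidef` (item Q1); this is the outline's "`0 ≤ re ∧ im = 0`".
* Isotony between the subtypes `↥Λ ⊆ ↥Λ'` is the accepted `embedOp h` (item Q3, which needs no
  `Fintype` on the ambient lattice); the outline's alternative form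
  `localOp (subFinset Λ Λ') (transportOp (subFinsetEquiv h) A)` is provided (`subFinset`,
  `subFinsetEquiv`) and identified with it in `embedOp_eq_localOp`.
* `IsBoxLimitOf`/`IsGibbsBoxLimitOf` evaluate a local observable `A ∈ 𝔄_Λ` in the box `box d L`
  only when `Λ ⊆ box d L`; the sequence has the **junk value** `0` for the finitely many `L` with
  `Λ ⊄ box d L`, which does not affect `Tendsto … atTop`.
* `thicken Λ R` uses `⌊R⌋₊`, so for `R < 0` it is the `0`-neighbourhood `Λ` (harmless: the
  derivation only depends on `thicken Λ R ⊇ Λ ∪ ⋃ {X ∋ Λ-site, diam X ≤ R}`).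
* `IsGappedGroundState ω Φ R γ` is the local criterion
  `-i ω(A⋆δ(A)) ≥ γ (ω(A⋆A) - |ω(A)|²)`; in the GNS representation (`H_ω Ω = 0`) it says
  `⟨ψ, H_ω ψ⟩ ≥ γ ‖(1 - |Ω⟩⟨Ω|) ψ‖²` on the dense set `ψ = π(A)Ω`, i.e. `ker H_ω = ℂΩ` and
  `spec H_ω ⊆ {0} ∪ [γ, ∞)` (Tasaki 2020, Def. A.16). The bridge to G07's
  `LinearPMap.HasGroundStateGap` is item Q15 (`isGappedGroundState_iff_hasGroundStateGap`).
-/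

noncomputable section

open Matrix Complex Finset Filter Topology
open scoped Matrix.Norms.L2Operator ComplexOrder InnerProductSpace

namespace Literature.MathematicalPhysics.QuantumLattice

open Literature.Probability.LatticeModels
open Literature.Probability.LatticeModels (Site box box_mono mem_box)

variable {d q : ℕ}

/-! ### Subregion plumbing -/

/-- The region `Λ ∩ Λ'` viewed inside the finite system on `↥Λ'`: `{x : ↥Λ' | ↑x ∈ Λ}` (Mathlib's
`Finset.subtype`). For `Λ ⊆ Λ'` this is a copy of `Λ`. Bratteli–Robinson II §6.2.1 (isotony).
[folklore] -/
def subFinset (Λ Λ' : Finset (Site d)) : Finset ↥Λ' :=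
  Λ.subtype (· ∈ Λ')

/-- Membership in `subFinset`. Bratteli–Robinson II §6.2.1. [folklore] -/
@[simp]
theorem mem_subFinset {Λ Λ' : Finset (Site d)} {x : ↥Λ'} :
    x ∈ subFinset Λ Λ' ↔ (x : Site d) ∈ Λ :=
  Finset.mem_subtype

/-- For `Λ ⊆ Λ'`, the sites of `Λ` are in bijection with `subFinset Λ Λ' ⊆ ↥Λ'`.
Bratteli–Robinson II §6.2.1 (isotony). [folklore] -/
def subFinsetEquiv {Λ Λ' : Finset (Site d)} (h : Λ ⊆ Λ') : ↥Λ ≃ ↥(subFinset Λ Λ') where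
  toFun x := ⟨⟨x, h x.2⟩, mem_subFinset.2 x.2⟩
  invFun y := ⟨y.1, mem_subFinset.1 y.2⟩
  left_inv _ := Subtype.ext rfl
  right_inv _ := Subtype.ext (Subtype.ext rfl)

/-- `subFinsetEquiv` unfolded. Bratteli–Robinson II §6.2.1. [folklore] -/
@[simp]
theorem coe_coe_subFinsetEquiv {Λ Λ' : Finset (Site d)} (h : Λ ⊆ Λ') (x : ↥Λ) :
    ((subFinsetEquiv h x : ↥Λ') : Site d) = x := rfl

/-- The isotony map `embedOp h : 𝔄_Λ → 𝔄_{Λ'}` (item Q3) is the local-operator embedding of `𝔄_Λ`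
at the copy `subFinset Λ Λ'` of `Λ` inside `↥Λ'` (elementary; recorded as a named fact).
Bratteli–Robinson II §6.2.1. [cite: BratteliRobinsonII1997, §6.2.1] -/
def embedOp_eq_localOp : Prop :=
  ∀ {Λ Λ' : Finset (Site d)} (h : Λ ⊆ Λ') (A : Op ↥Λ q),
    embedOp h A = localOp (subFinset Λ Λ') (transportOp (subFinsetEquiv h) A)

/-- Isotony `embedOp h` preserves adjoints. Bratteli–Robinson II §6.2.1. [folklore] -/
theorem embedOp_conjTranspose {Λ Λ' : Finset (Site d)} (h : Λ ⊆ Λ') (A : Op ↥Λ q) :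
    embedOp h Aᴴ = (embedOp h A)ᴴ := by
  ext σ τ
  simp only [embedOp, of_apply, conjTranspose_apply]
  have hc : (∀ y : ↥Λ', (y : Site d) ∉ Λ → σ y = τ y) ↔
      (∀ y : ↥Λ', (y : Site d) ∉ Λ → τ y = σ y) :=
    forall_congr' fun y => imp_congr_right fun _ => eq_comm
  rw [if_congr hc rfl rfl]
  split_ifs <;> simp

/-! ### Infinite-volume states -/

/-- An **infinite-volume state** of the quantum spin system on `ℤ^d` with local dimension `q`:
a compatible family of states `ω_Λ` on the local algebras `𝔄_Λ = Op ↥Λ q`, `Λ ⊆ ℤ^d` finite —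
each `ω_Λ` is a normalised positive linear functional and `ω_{Λ'} (A ⊗ 𝟙) = ω_Λ (A)` for
`Λ ⊆ Λ'`. Equivalently (item Q15) a state on the quasi-local C⋆-algebra `𝔄`.
Bratteli–Robinson II §6.2.1 and §2.6 (locally normal states); Tasaki (2020) App. A.7.
[cite: Tasaki2020] -/
structure InfVolState (d q : ℕ) where
  /-- The local expectation functionals `ω_Λ : 𝔄_Λ → ℂ`. -/
  expect : (Λ : Finset (Site d)) → Op ↥Λ q →ₗ[ℂ] ℂ
  /-- Normalisation `ω_Λ(𝟙) = 1`. -/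
  expect_one : ∀ Λ : Finset (Site d), expect Λ 1 = 1
  /-- Positivity `ω_Λ(A⋆A) ≥ 0` (in `ComplexOrder`: real part `≥ 0`, imaginary part `0`). -/
  expect_nonneg : ∀ (Λ : Finset (Site d)) (A : Op ↥Λ q), 0 ≤ expect Λ (Aᴴ * A)
  /-- Compatibility with isotony: `ω_{Λ'}(A ⊗ 𝟙_{Λ'∖Λ}) = ω_Λ(A)`. -/
  compatible : ∀ ⦃Λ Λ' : Finset (Site d)⦄ (h : Λ ⊆ Λ') (A : Op ↥Λ q),
    expect Λ' (embedOp h A) = expect Λ A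

namespace InfVolState

/-- Two infinite-volume states with the same local expectations are equal (a state of `𝔄` is
determined by its restrictions to the `𝔄_Λ`; Bratteli–Robinson II §6.2.1). [folklore] -/
@[ext]
theorem ext {ω₁ ω₂ : InfVolState d q} (h : ∀ Λ, ω₁.expect Λ = ω₂.expect Λ) : ω₁ = ω₂ := by
  cases ω₁; cases ω₂; congr; exact funext h

variable (ω : InfVolState d q)

/-- States are bounded by the operator norm: `|ω_Λ(A)| ≤ ‖A‖` (L²-operator norm), a consequence
of positivity and normalisation (Cauchy–Schwarz). Bratteli–Robinson I, Prop. 2.3.11;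
Bratteli–Robinson II §6.2.1. [cite: BratteliRobinsonI1987, Prop. 2.3.11] -/
def norm_expect_le : Prop :=
  ∀ (Λ : Finset (Site d)) (A : Op ↥Λ q),
    ‖ω.expect Λ A‖ ≤ ‖A‖

/-- States are Hermitian: `ω_Λ(Aᴴ) = conj (ω_Λ A)` (positivity implies Hermitian).
Bratteli–Robinson I, §2.3.2. [cite: BratteliRobinsonI1987, §2.3.2] -/
def expect_conjTranspose : Prop :=
  ∀ (Λ : Finset (Site d)) (A : Op ↥Λ q),
    ω.expect Λ Aᴴ = star (ω.expect Λ A)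

/-! ### Translations and rotations -/

/-- The relabelling of configurations induced by translating the region `Λ` by `v`:
`(↥Λ → Fin q) ≃ (↥(Λ + v) → Fin q)`. Bratteli–Robinson II §6.2.1 (space translations). [folklore] -/
def shiftIndexEquiv (v : Site d) (Λ : Finset (Site d)) :
    TensorIndex ↥Λ q ≃ TensorIndex ↥(Λ.map (Site.shift v).toEmbedding) q :=
  (finsetMapEquiv (Site.shift v).toEmbedding Λ).arrowCongr (Equiv.refl (Fin q))

/-- The **translate** `ω ∘ τ_v` of an infinite-volume state: `(shift v ω)_Λ (A) = ω_{Λ+v} (τ_v A)`,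
where `τ_v : 𝔄_Λ → 𝔄_{Λ+v}` transports along `x ↦ x + v` (`transportOp`, item Q5). This is again
an infinite-volume state (all fields proved). Bratteli–Robinson II §6.2.1, eq. (6.2.2).
[folklore] -/
def shift (v : Site d) (ω : InfVolState d q) : InfVolState d q where
  expect Λ := ω.expect (Λ.map (Site.shift v).toEmbedding) ∘ₗ
    (Matrix.reindexLinearEquiv ℂ ℂ (shiftIndexEquiv v Λ) (shiftIndexEquiv v Λ)).toLinearMap
  expect_one Λ := by
    simp only [LinearMap.coe_comp, Function.comp_apply, LinearEquiv.coe_coe,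
      Matrix.coe_reindexLinearEquiv,Matrix.reindex_apply, Matrix.submatrix_one_equiv]
    exact ω.expect_one _
  expect_nonneg Λ A := by
    simp only [LinearMap.coe_comp, Function.comp_apply, LinearEquiv.coe_coe,
      Matrix.coe_reindexLinearEquiv,Matrix.reindex_apply]
    rw [← Matrix.submatrix_mul_equiv (e₂ := (shiftIndexEquiv v Λ).symm),
      ← Matrix.conjTranspose_submatrix]
    exact ω.expect_nonneg _ _
  compatible Λ Λ' h A := by
    have h' : Λ.map (Site.shift v).toEmbedding ⊆
        Λ'.map (Site.shift v).toEmbedding := Finset.map_subset_map.2 h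
    simp only [LinearMap.coe_comp, Function.comp_apply, LinearEquiv.coe_coe,
      Matrix.coe_reindexLinearEquiv,Matrix.reindex_apply]
    rw [← ω.compatible h']
    congr 1
    ext σ τ
    simp only [Matrix.submatrix_apply, embedOp, of_apply]
    refine if_congr ⟨fun H y hy => ?_, fun H y hy => ?_⟩ rfl rfl
    · obtain ⟨x, rfl⟩ := (finsetMapEquiv _ Λ').surjective y
      have := H x (fun hm => hy ?_)
      · simpa [shiftIndexEquiv, Equiv.arrowCongr] using this
      · simpa using Finset.mem_map_of_mem (Site.shift v).toEmbedding hm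
    · have := H (finsetMapEquiv _ Λ' y) (fun hm => hy ?_)
      · simpa [shiftIndexEquiv, Equiv.arrowCongr] using this
      · obtain ⟨x, hx, hxy⟩ := Finset.mem_map.1 hm
        have : x = (y : Site d) := (Site.shift v).injective (by simpa using hxy)
        exact this ▸ hx

/-- The local expectations of the translated state (definitional unfolding).
Bratteli–Robinson II §6.2.1. [folklore] -/
theorem shift_expect (v : Site d) (Λ : Finset (Site d)) (A : Op ↥Λ q) :
    (ω.shift v).expect Λ A =
      ω.expect (Λ.map (Site.shift v).toEmbedding)
        (transportOp (finsetMapEquiv (Site.shift v).toEmbedding Λ) A) :=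
  rfl

/-- `ω` is **translation invariant**: `ω ∘ τ_v = ω` for all `v ∈ ℤ^d`.
Bratteli–Robinson II §6.2.1; Tasaki (2020) App. A.7. (Dot-namespaced; coexists with
`LatticeInteraction.IsTranslationInvariant`, outline §0.) [cite: Tasaki2020] -/
def IsTranslationInvariant (ω : InfVolState d q) : Prop :=
  ∀ v : Site d, ω.shift v = ω

/-- `ω` (local dimension `n + 1 = 2S + 1`) is **rotation invariant** (global `SU(2)` symmetry):
`ω_Λ (U(θ) A U(θ)ᴴ) = ω_Λ (A)` for every region, with `U(θ) = ⨂_{x∈Λ} exp(-iθ·𝐒_x)`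
(`globalRotation`). Tasaki (2020) §2.2 and App. A.7. [cite: Tasaki2020] -/
def IsRotationInvariant {n : ℕ} (ω : InfVolState d (n + 1)) : Prop :=
  ∀ (θ : Fin 3 → ℝ) (Λ : Finset (Site d)) (A : Op ↥Λ (n + 1)),
    ω.expect Λ (globalRotation n θ * A * (globalRotation n θ)ᴴ) = ω.expect Λ A

/-! ### Correlation functions and convex combinations -/

/-- The two-point function `ω(a_x b_y)` of the single-site observables `a` at `x` and `b` at `y`,
evaluated in the local algebra of the region `{x, y}`. Bratteli–Robinson II §6.2.1;
Tasaki (2020) App. A.7. [cite: Tasaki2020] -/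
def corr (x y : Site d) (a b : Matrix (Fin q) (Fin q) ℂ) : ℂ :=
  ω.expect {x, y}
    (onSite ⟨x, mem_insert_self x {y}⟩ a * onSite ⟨y, mem_insert_of_mem (mem_singleton_self y)⟩ b)

/-- The convex combination `t ω₁ + (1 - t) ω₂` (`0 ≤ t ≤ 1`) of two infinite-volume states.
Bratteli–Robinson I, §2.3.2 (the state space is convex). [folklore] -/
def mix (t : ℝ) (ht₀ : 0 ≤ t) (ht₁ : t ≤ 1) (ω₁ ω₂ : InfVolState d q) : InfVolState d q where
  expect Λ := (t : ℂ) • ω₁.expect Λ + ((1 - t : ℝ) : ℂ) • ω₂.expect Λ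
  expect_one Λ := by
    simp only [LinearMap.add_apply, LinearMap.smul_apply, ω₁.expect_one, ω₂.expect_one,
      smul_eq_mul, mul_one]
    push_cast
    ring
  expect_nonneg Λ A := by
    simp only [LinearMap.add_apply, LinearMap.smul_apply, smul_eq_mul]
    exact add_nonneg (mul_nonneg (Complex.zero_le_real.2 ht₀) (ω₁.expect_nonneg Λ A))
      (mul_nonneg (Complex.zero_le_real.2 (sub_nonneg.2 ht₁)) (ω₂.expect_nonneg Λ A))
  compatible Λ Λ' h A := by
    simp only [LinearMap.add_apply, LinearMap.smul_apply, ω₁.compatible h, ω₂.compatible h]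

/-- The local expectations of a convex combination (definitional unfolding).
Bratteli–Robinson I, §2.3.2. [folklore] -/
theorem mix_expect (t : ℝ) (ht₀ : 0 ≤ t) (ht₁ : t ≤ 1) (ω₁ ω₂ : InfVolState d q)
    (Λ : Finset (Site d)) (A : Op ↥Λ q) :
    (mix t ht₀ ht₁ ω₁ ω₂).expect Λ A = t * ω₁.expect Λ A + ((1 - t : ℝ) : ℂ) * ω₂.expect Λ A :=
  rfl

/-! ### Thermodynamic limits along boxes -/

/-- `ω` is the **thermodynamic limit of the vector states** `ψ_L ∈ 𝓗_{Λ_L}`, `Λ_L = box d L`: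
for every local observable `A ∈ 𝔄_Λ`, `⟨ψ_L, (A ⊗ 𝟙) ψ_L⟩ → ω_Λ(A)` as `L → ∞` (junk value `0`
for the finitely many `L` with `Λ ⊄ Λ_L`). Normalisation `‖ψ_L‖ → 1` is forced by `ω(𝟙) = 1`.
Tasaki (2020) App. A.7, eq. (A.7.4); Bratteli–Robinson II §6.2.7. [cite: Tasaki2020] -/
def IsBoxLimitOf (ψ : ∀ L, SpinSpace ↥(box d L) q) : Prop :=
  ∀ (Λ : Finset (Site d)) (A : Op ↥Λ q),
    Tendsto (fun L => if h : Λ ⊆ box d L then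
        ⟪ψ L, Matrix.toEuclideanLin (embedOp h A) (ψ L)⟫_ℂ else 0)
      atTop (𝓝 (ω.expect Λ A))

/-- `ω` is a **thermodynamic limit of the finite-volume Gibbs states** of the interaction `Φ` at
inverse temperature `β` with open boundary conditions: `tr(e^{-βH_L} (A ⊗ 𝟙)) / Z_L → ω_Λ(A)`
for every `A ∈ 𝔄_Λ`, `H_L = boxHamiltonian Φ L` (junk value `0` while `Λ ⊄ box d L`).
Bratteli–Robinson II §6.2.2 (thermodynamic limit of Gibbs states); Tasaki (2020) App. A.7.
[cite: Tasaki2020] -/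
def IsGibbsBoxLimitOf (Φ : LatticeInteraction d q) (β : ℝ) : Prop :=
  ∀ (Λ : Finset (Site d)) (A : Op ↥Λ q),
    Tendsto (fun L => if h : Λ ⊆ box d L then
        (boxHamiltonian Φ L).gibbsState β (embedOp h A) else 0)
      atTop (𝓝 (ω.expect Λ A))

end InfVolState

/-! ### The generator of the dynamics on local observables -/

/-- The `R`-neighbourhood `{x ∈ ℤ^d | dist(x, Λ) ≤ R} = Λ + {-⌊R⌋, …, ⌊R⌋}^d` of a finite region
(sup metric). For `R < 0` this is `Λ` (we use `⌊R⌋₊`). Every term `Φ X` of an interaction of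
range `R` with `X ∩ Λ ≠ ∅` lives in `thicken Λ R`. Bratteli–Robinson II §6.2.1, proof of
Thm. 6.2.4. [folklore] -/
def thicken (Λ : Finset (Site d)) (R : ℝ) : Finset (Site d) :=
  Λ.biUnion fun y => (box d ⌊R⌋₊).image fun v => y + v

/-- `Λ ⊆ thicken Λ R`. Bratteli–Robinson II §6.2.1. [folklore] -/
theorem subset_thicken (Λ : Finset (Site d)) (R : ℝ) : Λ ⊆ thicken Λ R := by
  intro y hy
  refine mem_biUnion.2 ⟨y, hy, mem_image.2 ⟨0, ?_, add_zero y⟩⟩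
  simp [mem_box]

/-- `thicken Λ` is monotone in the radius. Bratteli–Robinson II §6.2.1. [folklore] -/
theorem thicken_mono (Λ : Finset (Site d)) {R R' : ℝ} (h : R ≤ R') :
    thicken Λ R ⊆ thicken Λ R' :=
  biUnion_subset_biUnion_of_subset_left _ le_rfl |>.trans <|
    biUnion_mono fun _ _ => image_subset_image (box_mono d (Nat.floor_le_floor h))

/-- The **derivation** generating the dynamics of the interaction `Φ` (of finite range `R`) on the
local observable `A ∈ 𝔄_Λ`: `δ(A) = i [H_{Λ_R}, A ⊗ 𝟙] ∈ 𝔄_{Λ_R}`, `Λ_R = thicken Λ R`,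
`H_{Λ_R} = Σ_{X ⊆ Λ_R} Φ X`. For `Φ` of range `≤ R` this does not depend on `R`
(`derivation_indep_of_range`) and `τ_t = e^{tδ}` on `⋃ 𝔄_Λ`. Bratteli–Robinson II Thm. 6.2.4,
eq. (6.2.9); Nachtergaele–Sims (2006) §2. [cite: NachtergaeleSims2006] -/
def derivation (Φ : LatticeInteraction d q) (R : ℝ) (Λ : Finset (Site d)) (A : Op ↥Λ q) :
    Op ↥(thicken Λ R) q :=
  I • (localHamiltonian (Φ.restrict (thicken Λ R)) univ * embedOp (subset_thicken Λ R) A -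
    embedOp (subset_thicken Λ R) A * localHamiltonian (Φ.restrict (thicken Λ R)) univ)

/-- For an interaction of finite range `R ≤ R'`, the derivations computed in the `R`- and the
`R'`-neighbourhoods agree in `𝔄_{thicken Λ R'}` (the extra terms of `H` commute with `A`).
Bratteli–Robinson II, proof of Thm. 6.2.4. [cite: BratteliRobinsonII1997, Thm. 6.2.4 (proof)] -/
def derivation_indep_of_range : Prop :=
  ∀ {Φ : LatticeInteraction d q} {R R' : ℝ} (hΦ : Φ.HasFiniteRange R) (hR : R ≤ R') (Λ : Finset (Site d)) (A : Op ↥Λ q),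
    embedOp (thicken_mono Λ hR) (derivation Φ R Λ A) = derivation Φ R' Λ A

/-- The derivation of a Hermitian interaction is a ⋆-derivation: `δ(Aᴴ) = δ(A)ᴴ`.
Bratteli–Robinson II Thm. 6.2.4 (proved below, `derivation_conjTranspose_holds`).
[cite: BratteliRobinsonII1997, Thm. 6.2.4] -/
def derivation_conjTranspose : Prop :=
  ∀ {Φ : LatticeInteraction d q} (hΦ : Φ.IsHermitian) (R : ℝ) (Λ : Finset (Site d))
    (A : Op ↥Λ q), derivation Φ R Λ Aᴴ = (derivation Φ R Λ A)ᴴ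

/-- Discharge of the named fact `derivation_conjTranspose`: `δ(Aᴴ) = δ(A)ᴴ` for a Hermitian
interaction, from `localHamiltonian_isHermitian` and `embedOp_conjTranspose`.
Bratteli–Robinson II Thm. 6.2.4. [cite: BratteliRobinsonII1997, Thm. 6.2.4] -/
theorem derivation_conjTranspose_holds : derivation_conjTranspose (d := d) (q := q) := by
  intro Φ hΦ R Λ A
  have hH := (localHamiltonian_isHermitian (hΦ.isLocal_restrict (thicken Λ R)) Finset.univ).eq
  simp only [derivation, Matrix.conjTranspose_smul, Matrix.conjTranspose_sub,
    Matrix.conjTranspose_mul, hH, embedOp_conjTranspose]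
  rw [Complex.star_def, Complex.conj_I, neg_smul, ← smul_neg, neg_sub]

/-! ### Ground states -/

namespace InfVolState

variable (ω : InfVolState d q)

/-- `ω` is a **ground state** of the finite-range interaction `Φ` (range `R`): for every local
observable `A`, `-i ω(A⋆ δ(A)) ≥ 0` (in `ComplexOrder`, i.e. real part `≥ 0` and imaginary part
`0`), where `δ = derivation Φ R` and `A⋆ δ(A)` is computed in `𝔄_{thicken Λ R}`.
Bratteli–Robinson II Def. 5.3.18 / Prop. 5.3.19 and §6.2.7; Tasaki (2020) Def. A.14.
[cite: Tasaki2020] -/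
def IsGroundState (Φ : LatticeInteraction d q) (R : ℝ) : Prop :=
  ∀ (Λ : Finset (Site d)) (A : Op ↥Λ q),
    0 ≤ -I * ω.expect (thicken Λ R)
      ((embedOp (subset_thicken Λ R) A)ᴴ * derivation Φ R Λ A)

/-- `ω` is a **gapped ground state** of `Φ` with gap `γ > 0`: it is a ground state and
`-i ω(A⋆ δ(A)) ≥ γ (ω(A⋆A) - |ω(A)|²)` for every local `A`. In the GNS representation
(`H_ω ≥ 0`, `H_ω Ω_ω = 0`) this says `ker H_ω = ℂ Ω_ω` and `spec H_ω ⊆ {0} ∪ [γ, ∞)`; the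
equivalence with G07's `LinearPMap.HasGroundStateGap` is proved in item Q15
(`isGappedGroundState_iff_hasGroundStateGap`). Tasaki (2020) Def. A.16 and Lemma A.17;
Bratteli–Robinson II Prop. 5.3.19, §6.2.7. [cite: Tasaki2020] -/
def IsGappedGroundState (Φ : LatticeInteraction d q) (R γ : ℝ) : Prop :=
  ω.IsGroundState Φ R ∧ 0 < γ ∧
    ∀ (Λ : Finset (Site d)) (A : Op ↥Λ q),
      ((γ * ((ω.expect Λ (Aᴴ * A)).re - ‖ω.expect Λ A‖ ^ 2) : ℝ) : ℂ) ≤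
        -I * ω.expect (thicken Λ R) ((embedOp (subset_thicken Λ R) A)ᴴ * derivation Φ R Λ A)

/-- A gapped ground state is a ground state. Tasaki (2020) Def. A.16. [cite: Tasaki2020] -/
theorem IsGappedGroundState.isGroundState {ω : InfVolState d q} {Φ : LatticeInteraction d q}
    {R γ : ℝ} (h : ω.IsGappedGroundState Φ R γ) : ω.IsGroundState Φ R :=
  h.1

/-- The gap of a gapped ground state is positive. Tasaki (2020) Def. A.16. [cite: Tasaki2020] -/
theorem IsGappedGroundState.pos {ω : InfVolState d q} {Φ : LatticeInteraction d q}
    {R γ : ℝ} (h : ω.IsGappedGroundState Φ R γ) : 0 < γ :=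
  h.2.1

/-- Gapped ground states are antitone in the gap. Tasaki (2020) Def. A.16. [cite: Tasaki2020] -/
def IsGappedGroundState.anti : Prop :=
  ∀ {ω : InfVolState d q} {Φ : LatticeInteraction d q} {R γ γ' : ℝ} (h : ω.IsGappedGroundState Φ R γ) (hγ' : 0 < γ') (hle : γ' ≤ γ),
    ω.IsGappedGroundState Φ R γ'

/-- **Thermodynamic limits of finite-volume ground states are ground states**: if `ψ_L` is a
ground-state vector of `H_L = boxHamiltonian Φ L` for every `L` and `⟨ψ_L, · ψ_L⟩ → ω`, then `ω`
is an infinite-volume ground state of `Φ`. Tasaki (2020) App. A.7, Lemma A.15;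
Bratteli–Robinson II Prop. 5.3.25 / §6.2.7. [cite: Tasaki2020] -/
def IsGroundState.of_isBoxLimitOf : Prop :=
  ∀ {ω : InfVolState d q} {Φ : LatticeInteraction d q} {R : ℝ} (hΦ : Φ.HasFiniteRange R) (hH : Φ.IsHermitian) {ψ : ∀ L, SpinSpace ↥(box d L) q} (hψ : ∀ L, (boxHamiltonian Φ L).IsGroundStateVector (WithLp.ofLp (ψ L))) (hlim : ω.IsBoxLimitOf ψ),
    ω.IsGroundState Φ R

end InfVolState

/-- The set of infinite-volume ground states of the finite-range interaction `Φ` (range `R`).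
Bratteli–Robinson II §6.2.7; Tasaki (2020) App. A.7. [cite: Tasaki2020] -/
def groundStates (Φ : LatticeInteraction d q) (R : ℝ) : Set (InfVolState d q) :=
  {ω | ω.IsGroundState Φ R}

/-- Membership in `groundStates` (definitional). Bratteli–Robinson II §6.2.7. [folklore] -/
@[simp]
theorem mem_groundStates {Φ : LatticeInteraction d q} {R : ℝ} {ω : InfVolState d q} :
    ω ∈ groundStates Φ R ↔ ω.IsGroundState Φ R :=
  Iff.rfl

/-- `Φ` has a **unique infinite-volume ground state**. Tasaki (2020) Def. A.16;
Bratteli–Robinson II §6.2.7. [cite: Tasaki2020] -/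
def HasUniqueGroundState (Φ : LatticeInteraction d q) (R : ℝ) : Prop :=
  ∃! ω : InfVolState d q, ω.IsGroundState Φ R

/-- `Φ` has a **unique gapped ground state**: a unique infinite-volume ground state, which is
moreover gapped for some `γ > 0`. Tasaki (2020) Def. A.16 ("unique gapped ground state").
[cite: Tasaki2020] -/
def HasUniqueGappedGroundState (Φ : LatticeInteraction d q) (R : ℝ) : Prop :=
  HasUniqueGroundState Φ R ∧ ∃ (ω : InfVolState d q) (γ : ℝ), ω.IsGappedGroundState Φ R γ

/-- A unique gapped ground state is in particular a unique ground state. Tasaki (2020) Def. A.16.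
[cite: Tasaki2020] -/
theorem HasUniqueGappedGroundState.hasUniqueGroundState {Φ : LatticeInteraction d q} {R : ℝ}
    (h : HasUniqueGappedGroundState Φ R) : HasUniqueGroundState Φ R :=
  h.1

/-- **The set of ground states is convex** (the defining inequality is linear in `ω`).
Bratteli–Robinson II Prop. 5.3.19 ff. (the ground states form a weak⋆-closed convex set,
Thm. 5.3.37); Tasaki (2020) App. A.7. [cite: Tasaki2020] -/
def groundStates_convex : Prop :=
  ∀ {Φ : LatticeInteraction d q} {R : ℝ} {ω₁ ω₂ : InfVolState d q} (h₁ : ω₁ ∈ groundStates Φ R) (h₂ : ω₂ ∈ groundStates Φ R) (t : ℝ) (ht₀ : 0 ≤ t) (ht₁ : t ≤ 1),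
    InfVolState.mix t ht₀ ht₁ ω₁ ω₂ ∈ groundStates Φ R

end Literature.MathematicalPhysics.QuantumLattice
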